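import Summits.MatrixMultiplication.MatrixMultiplication.Theorems.AbelianSTPPCensusShapeCertVPDefs

/-!
# Abelian STPP census — kernel evaluation of the vP certificate checker `ShapeCertVP` (I: orders 318–325)

Cell mm-stpp, route `AbelianSTPPCensusVP`, crux `ShapeExclusionVP337` (stmt-MatrixMultiplication-19191); support file
(no definitions).  `ShapeCertVP.checkV M = true` by `decide +kernel` (no `native_decide`, standard axioms), ONE theorem
per order so that every kernel evaluation starts with empty caches (measured in the seat folder: ≈ 4–8 s per order below
300, ≤ 35 s at the orders 300–337 — candidate-list construction plus the `feasP` packings of the visited nodes);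
`Elab.async false` keeps the evaluations of this file sequential (one kernel computation in memory at a time; tree
precedent `NeelSignC23EK0Cert4`).  The range lemma `checkV_318_325` at the end collects the file; the ten ranges are
assembled on `128 ≤ M ≤ 337` in `AbelianSTPPCensusVPShapeExclusionVP337.lean`, where `ShapeCertVP.checkV_sound`
(`…ShapeCertVPSearch`) and the bridge `ShapeCertVP.shapeExclusionVP_of_checkV` (`…ShapeCertVPFinal`) turn them into
the crux.
-/

set_option linter.dupNamespace false -- `MatrixMultiplication.MatrixMultiplication` (summit = problem, D-0017)
set_option autoImplicit false
set_option Elab.async false -- sequential kernel evaluations (memory high-water of one order at a time)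

namespace Summit.MatrixMultiplication.MatrixMultiplication.Theorems.ShapeCertVP

set_option maxHeartbeats 0 in
/-- certificate check at order `318` (kernel evaluation) -/
theorem checkV_318 : checkV 318 = true := by
  decide +kernel

set_option maxHeartbeats 0 in
/-- certificate check at order `319` (kernel evaluation) -/
theorem checkV_319 : checkV 319 = true := by
  decide +kernel

set_option maxHeartbeats 0 in
/-- certificate check at order `320` (kernel evaluation) -/
theorem checkV_320 : checkV 320 = true := by
  decide +kernel

set_option maxHeartbeats 0 in
/-- certificate check at order `321` (kernel evaluation) -/
theorem checkV_321 : checkV 321 = true := by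
  decide +kernel

set_option maxHeartbeats 0 in
/-- certificate check at order `322` (kernel evaluation) -/
theorem checkV_322 : checkV 322 = true := by
  decide +kernel

set_option maxHeartbeats 0 in
/-- certificate check at order `323` (kernel evaluation) -/
theorem checkV_323 : checkV 323 = true := by
  decide +kernel

set_option maxHeartbeats 0 in
/-- certificate check at order `324` (kernel evaluation) -/
theorem checkV_324 : checkV 324 = true := by
  decide +kernel

set_option maxHeartbeats 0 in
/-- certificate check at order `325` (kernel evaluation) -/
theorem checkV_325 : checkV 325 = true := by
  decide +kernel

/-- **The vP certificate holds at every order `318 ≤ M ≤ 325`** (collects the evaluations of this file). -/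
theorem checkV_318_325 (M : ℕ) (h₁ : 318 ≤ M) (h₂ : M ≤ 325) : checkV M = true := by
  interval_cases M
  · exact checkV_318
  · exact checkV_319
  · exact checkV_320
  · exact checkV_321
  · exact checkV_322
  · exact checkV_323
  · exact checkV_324
  · exact checkV_325

end Summit.MatrixMultiplication.MatrixMultiplication.Theorems.ShapeCertVP
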